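import Mathlib
import Summits.Ventures.PercRepro2.Defs
import Summits.Ventures.PercRepro2.Independence
import Summits.Ventures.PercRepro2.Graph
import Summits.Ventures.PercRepro2.Events
import Summits.Ventures.PercRepro2.Frontier
import Summits.Ventures.PercRepro2.BHKAvoid
import Summits.Ventures.PercRepro2.R2PrimeThreeReduction
import Summits.Ventures.PercRepro2.YBridge
import Summits.Ventures.PercRepro2.HCov
import Summits.Ventures.PercRepro2.BasePendant
import Summits.Ventures.PercRepro2.TwoTerminalReduction
import Summits.Ventures.PercRepro2.PMPendantLeaf

/-!
# The masses of the covariance form at a pendant `a₃`: pinning the leaf edge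
(blind cell PercRepro2, mine-2 g22; row 2′BETA1 / the weighted (PM) dictionary, proofs/MINE2-CUTU.md §13;
second file, on `PMPendantLeaf.lean`)

`a₃` is a LEAF of the graph, its only edge `f = {a₃, u}` of weight `t = p f`.  Every mass of the
covariance form `Gc` (`HCov.lean`) is a probability of an event of the connectivity relation, so by the
pinning identity `prob_eq_pin` it is `t · (mass at p[f ↦ 1]) + (1 − t) · (mass at p[f ↦ 0])`
(`prob_PD_pin`, `Do_pin`, …).  With the leaf edge pinned OPEN, `a₃` is connected to exactly what `u` is
(`conn_leaf_open`), so every `a₃`-mass at `p[f ↦ 1]` is the same mass function at `p[f ↦ 0]` with `u` in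
the place of `a₃` (`prob_PD_one`, `Do_one`, `EQb3_one`, …); with the leaf edge pinned CLOSED, `a₃` is
isolated, so the `T`-masses (`a₃` in a root cluster) vanish (`EQb3_zero`, `EQb3o_zero`, `EQ3_zero`,
`EQ3o_zero`).  The `a₃`-free masses (`P(Q)`, `E_Q[σ_b σ_o]`, `gap`, `E_Q[σ_o]`) do not see `f` at all
(`prob_Q_free`, `EQbo_free`, `gap_free`, `EQo_free`).  `PMPendantDict.lean` assembles the dictionary.
-/

namespace Summit.Ventures.PercRepro2

open CovForm UnionCluster

namespace PMPendant

/-! ## The masses of `Gc`: pinning, the open leaf (`a₃ := u`), the closed leaf -/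

section Pin

variable {V : Type*} {E : Type*} [Fintype E] [DecidableEq E] [DecidableEq V]
  {R : Type*} [Field R] [LinearOrder R]
  {ends : E → Sym2 V} {a₃ : V} {f : E} (p : E → R) (o a₁ a₂ b : V)

/-! ### Pinning the leaf edge: every mass is `t · (mass at p[f ↦ 1]) + (1 − t) · (mass at p[f ↦ 0])` -/

omit [DecidableEq V] [LinearOrder R] in
/-- Pinning `f` in `P(PD)`. -/
lemma prob_PD_pin : prob p (PDEvent ends a₁ a₂ a₃) =
    p f * prob (Function.update p f 1) (PDEvent ends a₁ a₂ a₃) +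
      (1 - p f) * prob (Function.update p f 0) (PDEvent ends a₁ a₂ a₃) :=
  prob_eq_pin p _ f

omit [DecidableEq V] [LinearOrder R] in
/-- Pinning `f` in `D_o`. -/
lemma Do_pin : Do p ends o a₁ a₂ a₃ =
    p f * Do (Function.update p f 1) ends o a₁ a₂ a₃ + (1 - p f) * Do (Function.update p f 0) ends o a₁ a₂ a₃ := by
  unfold Do
  simp only [prob_eq_pin p _ f]
  ring

omit [DecidableEq V] [LinearOrder R] in
/-- Pinning `f` in `E_Q[σ_b σ₃]`. -/
lemma EQb3_pin : EQb3 p ends a₁ a₂ a₃ b =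
    p f * EQb3 (Function.update p f 1) ends a₁ a₂ a₃ b +
      (1 - p f) * EQb3 (Function.update p f 0) ends a₁ a₂ a₃ b := by
  unfold EQb3
  simp only [prob_eq_pin p _ f]
  ring

omit [DecidableEq V] [LinearOrder R] in
/-- Pinning `f` in `E_Q[σ_b σ₃ 1_{o ∈ U}]`. -/
lemma EQb3o_pin : EQb3o p ends o a₁ a₂ a₃ b =
    p f * EQb3o (Function.update p f 1) ends o a₁ a₂ a₃ b +
      (1 - p f) * EQb3o (Function.update p f 0) ends o a₁ a₂ a₃ b := by
  unfold EQb3o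
  simp only [prob_eq_pin p _ f]
  ring

omit [DecidableEq V] [LinearOrder R] in
/-- Pinning `f` in `E_Q[σ₃]`. -/
lemma EQ3_pin : EQ3 p ends a₁ a₂ a₃ =
    p f * EQ3 (Function.update p f 1) ends a₁ a₂ a₃ + (1 - p f) * EQ3 (Function.update p f 0) ends a₁ a₂ a₃ := by
  unfold EQ3
  simp only [prob_eq_pin p _ f]
  ring

omit [DecidableEq V] [LinearOrder R] in
/-- Pinning `f` in `E_Q[σ₃ 1_{o ∈ U}]`. -/
lemma EQ3o_pin : EQ3o p ends o a₁ a₂ a₃ =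
    p f * EQ3o (Function.update p f 1) ends o a₁ a₂ a₃ +
      (1 - p f) * EQ3o (Function.update p f 0) ends o a₁ a₂ a₃ := by
  unfold EQ3o
  simp only [prob_eq_pin p _ f]
  ring

omit [DecidableEq V] [LinearOrder R] in
/-- Pinning `f` in `P(PD, b ∈ U)`. -/
lemma PDb_pin : PDb p ends a₁ a₂ a₃ b =
    p f * PDb (Function.update p f 1) ends a₁ a₂ a₃ b + (1 - p f) * PDb (Function.update p f 0) ends a₁ a₂ a₃ b := by
  unfold PDb
  simp only [prob_eq_pin p _ f]
  ring

omit [DecidableEq V] [LinearOrder R] in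
/-- Pinning `f` in `P(PD, b ∈ U, o ∈ U)`. -/
lemma PDbo_pin : PDbo p ends o a₁ a₂ a₃ b =
    p f * PDbo (Function.update p f 1) ends o a₁ a₂ a₃ b +
      (1 - p f) * PDbo (Function.update p f 0) ends o a₁ a₂ a₃ b := by
  unfold PDbo
  simp only [prob_eq_pin p _ f]
  ring

end Pin

section Masses

variable {V : Type*} {E : Type*} [Fintype E] [DecidableEq E] [DecidableEq V]
  {R : Type*} [Field R] [LinearOrder R]
  {ends : E → Sym2 V} {a₃ u : V} {f : E}
  (hf : ends f = s(a₃, u)) (hleaf : ∀ e, a₃ ∈ ends e → e = f) (h3u : a₃ ≠ u)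
  (p : E → R) (o a₁ a₂ b : V)
include hf hleaf h3u

/-! ### The leaf edge open: `a₃` is `u` -/

omit [DecidableEq V] [LinearOrder R] in
/-- `P(PD)` with the leaf edge open is `P(PD)` with `u` in the place of `a₃`. -/
lemma prob_PD_one (h31 : a₁ ≠ a₃) (h32 : a₂ ≠ a₃) :
    prob (Function.update p f 1) (PDEvent ends a₁ a₂ a₃) = prob (Function.update p f 0) (PDEvent ends a₁ a₂ u) := by
  refine prob_one_eq p (fun ω hω => ?_) (dependsOn_PD hf hleaf h3u h31 h32 h3u.symm)
  simp only [PDEvent, Dtilde, Set.mem_inter_iff, Set.mem_compl_iff, mem_inU, mem_connEvent,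
    conn_leaf_open hf hω]

omit [DecidableEq V] [LinearOrder R] in
/-- `D_o` with the leaf edge open. -/
lemma Do_one (h3o : o ≠ a₃) (h31 : a₁ ≠ a₃) (h32 : a₂ ≠ a₃) :
    Do (Function.update p f 1) ends o a₁ a₂ a₃ = Do (Function.update p f 0) ends o a₁ a₂ u := by
  unfold Do
  rw [prob_one_eq p (X' := PDEvent ends a₁ a₂ u ∩ connEvent ends a₁ o) (fun ω hω => ?_)
      (dependsOn_inter_same (dependsOn_PD hf hleaf h3u h31 h32 h3u.symm)
        (dependsOn_connEvent_leaf hf hleaf h3u h31 h3o)),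
    prob_one_eq p (X' := PDEvent ends a₁ a₂ u ∩ connEvent ends a₂ o) (fun ω hω => ?_)
      (dependsOn_inter_same (dependsOn_PD hf hleaf h3u h31 h32 h3u.symm)
        (dependsOn_connEvent_leaf hf hleaf h3u h32 h3o))]
  all_goals simp only [PDEvent, Dtilde, Set.mem_inter_iff, Set.mem_compl_iff, mem_inU, mem_connEvent,
    conn_leaf_open hf hω]

omit [DecidableEq V] [LinearOrder R] in
/-- `E_Q[σ_b σ₃]` with the leaf edge open. -/
lemma EQb3_one (h31 : a₁ ≠ a₃) (h32 : a₂ ≠ a₃) (h3b : b ≠ a₃) :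
    EQb3 (Function.update p f 1) ends a₁ a₂ a₃ b = EQb3 (Function.update p f 0) ends a₁ a₂ u b := by
  unfold EQb3
  rw [prob_one_eq p (X' := TEvent ends a₂ a₁ u ∩ connEvent ends a₁ b) (fun ω hω => ?_)
      (dependsOn_inter_same (dependsOn_T hf hleaf h3u h32 h31 h3u.symm)
        (dependsOn_connEvent_leaf hf hleaf h3u h31 h3b)),
    prob_one_eq p (X' := TEvent ends a₁ a₂ u ∩ connEvent ends a₂ b) (fun ω hω => ?_)
      (dependsOn_inter_same (dependsOn_T hf hleaf h3u h31 h32 h3u.symm)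
        (dependsOn_connEvent_leaf hf hleaf h3u h32 h3b)),
    prob_one_eq p (X' := TEvent ends a₁ a₂ u ∩ connEvent ends a₁ b) (fun ω hω => ?_)
      (dependsOn_inter_same (dependsOn_T hf hleaf h3u h31 h32 h3u.symm)
        (dependsOn_connEvent_leaf hf hleaf h3u h31 h3b)),
    prob_one_eq p (X' := TEvent ends a₂ a₁ u ∩ connEvent ends a₂ b) (fun ω hω => ?_)
      (dependsOn_inter_same (dependsOn_T hf hleaf h3u h32 h31 h3u.symm)
        (dependsOn_connEvent_leaf hf hleaf h3u h32 h3b))]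
  all_goals simp only [TEvent, Set.mem_inter_iff, Set.mem_compl_iff, mem_connEvent,
    conn_leaf_open' hf hω]

omit [DecidableEq V] [LinearOrder R] in
/-- `E_Q[σ_b σ₃ 1_{o ∈ U}]` with the leaf edge open. -/
lemma EQb3o_one (h3o : o ≠ a₃) (h31 : a₁ ≠ a₃) (h32 : a₂ ≠ a₃) (h3b : b ≠ a₃) :
    EQb3o (Function.update p f 1) ends o a₁ a₂ a₃ b = EQb3o (Function.update p f 0) ends o a₁ a₂ u b := by
  unfold EQb3o
  have dT := dependsOn_T hf hleaf h3u h31 h32 h3u.symm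
  have dT' := dependsOn_T hf hleaf h3u h32 h31 h3u.symm
  have d1o := dependsOn_connEvent_leaf hf hleaf h3u h31 h3o
  have d2o := dependsOn_connEvent_leaf hf hleaf h3u h32 h3o
  have d1b := dependsOn_connEvent_leaf hf hleaf h3u h31 h3b
  have d2b := dependsOn_connEvent_leaf hf hleaf h3u h32 h3b
  rw [prob_one_eq p (X' := TEvent ends a₂ a₁ u ∩ (connEvent ends a₁ o ∩ connEvent ends a₁ b))
      (fun ω hω => ?_) (dependsOn_inter_same dT' (dependsOn_inter_same d1o d1b)),
    prob_one_eq p (X' := TEvent ends a₂ a₁ u ∩ (connEvent ends a₂ o ∩ connEvent ends a₁ b))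
      (fun ω hω => ?_) (dependsOn_inter_same dT' (dependsOn_inter_same d2o d1b)),
    prob_one_eq p (X' := TEvent ends a₁ a₂ u ∩ (connEvent ends a₁ o ∩ connEvent ends a₂ b))
      (fun ω hω => ?_) (dependsOn_inter_same dT (dependsOn_inter_same d1o d2b)),
    prob_one_eq p (X' := TEvent ends a₁ a₂ u ∩ (connEvent ends a₂ o ∩ connEvent ends a₂ b))
      (fun ω hω => ?_) (dependsOn_inter_same dT (dependsOn_inter_same d2o d2b)),
    prob_one_eq p (X' := TEvent ends a₁ a₂ u ∩ (connEvent ends a₁ o ∩ connEvent ends a₁ b))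
      (fun ω hω => ?_) (dependsOn_inter_same dT (dependsOn_inter_same d1o d1b)),
    prob_one_eq p (X' := TEvent ends a₁ a₂ u ∩ (connEvent ends a₂ o ∩ connEvent ends a₁ b))
      (fun ω hω => ?_) (dependsOn_inter_same dT (dependsOn_inter_same d2o d1b)),
    prob_one_eq p (X' := TEvent ends a₂ a₁ u ∩ (connEvent ends a₁ o ∩ connEvent ends a₂ b))
      (fun ω hω => ?_) (dependsOn_inter_same dT' (dependsOn_inter_same d1o d2b)),
    prob_one_eq p (X' := TEvent ends a₂ a₁ u ∩ (connEvent ends a₂ o ∩ connEvent ends a₂ b))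
      (fun ω hω => ?_) (dependsOn_inter_same dT' (dependsOn_inter_same d2o d2b))]
  all_goals simp only [TEvent, Set.mem_inter_iff, Set.mem_compl_iff, mem_connEvent,
    conn_leaf_open' hf hω]

omit [DecidableEq V] [LinearOrder R] in
/-- `E_Q[σ₃]` with the leaf edge open. -/
lemma EQ3_one (h31 : a₁ ≠ a₃) (h32 : a₂ ≠ a₃) :
    EQ3 (Function.update p f 1) ends a₁ a₂ a₃ = EQ3 (Function.update p f 0) ends a₁ a₂ u := by
  unfold EQ3
  rw [prob_one_eq p (X' := TEvent ends a₂ a₁ u) (fun ω hω => ?_) (dependsOn_T hf hleaf h3u h32 h31 h3u.symm),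
    prob_one_eq p (X' := TEvent ends a₁ a₂ u) (fun ω hω => ?_) (dependsOn_T hf hleaf h3u h31 h32 h3u.symm)]
  all_goals simp only [TEvent, Set.mem_inter_iff, Set.mem_compl_iff, mem_connEvent,
    conn_leaf_open' hf hω]

omit [DecidableEq V] [LinearOrder R] in
/-- `E_Q[σ₃ 1_{o ∈ U}]` with the leaf edge open. -/
lemma EQ3o_one (h3o : o ≠ a₃) (h31 : a₁ ≠ a₃) (h32 : a₂ ≠ a₃) :
    EQ3o (Function.update p f 1) ends o a₁ a₂ a₃ = EQ3o (Function.update p f 0) ends o a₁ a₂ u := by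
  unfold EQ3o
  have dT := dependsOn_T hf hleaf h3u h31 h32 h3u.symm
  have dT' := dependsOn_T hf hleaf h3u h32 h31 h3u.symm
  have d1o := dependsOn_connEvent_leaf hf hleaf h3u h31 h3o
  have d2o := dependsOn_connEvent_leaf hf hleaf h3u h32 h3o
  rw [prob_one_eq p (X' := TEvent ends a₂ a₁ u ∩ connEvent ends a₁ o) (fun ω hω => ?_)
      (dependsOn_inter_same dT' d1o),
    prob_one_eq p (X' := TEvent ends a₂ a₁ u ∩ connEvent ends a₂ o) (fun ω hω => ?_)
      (dependsOn_inter_same dT' d2o),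
    prob_one_eq p (X' := TEvent ends a₁ a₂ u ∩ connEvent ends a₁ o) (fun ω hω => ?_)
      (dependsOn_inter_same dT d1o),
    prob_one_eq p (X' := TEvent ends a₁ a₂ u ∩ connEvent ends a₂ o) (fun ω hω => ?_)
      (dependsOn_inter_same dT d2o)]
  all_goals simp only [TEvent, Set.mem_inter_iff, Set.mem_compl_iff, mem_connEvent,
    conn_leaf_open' hf hω]

omit [DecidableEq V] [LinearOrder R] in
/-- `P(PD, b ∈ U)` with the leaf edge open. -/
lemma PDb_one (h31 : a₁ ≠ a₃) (h32 : a₂ ≠ a₃) (h3b : b ≠ a₃) :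
    PDb (Function.update p f 1) ends a₁ a₂ a₃ b = PDb (Function.update p f 0) ends a₁ a₂ u b := by
  unfold PDb
  have dPD := dependsOn_PD hf hleaf h3u h31 h32 h3u.symm
  rw [prob_one_eq p (X' := PDEvent ends a₁ a₂ u ∩ connEvent ends a₁ b) (fun ω hω => ?_)
      (dependsOn_inter_same dPD (dependsOn_connEvent_leaf hf hleaf h3u h31 h3b)),
    prob_one_eq p (X' := PDEvent ends a₁ a₂ u ∩ connEvent ends a₂ b) (fun ω hω => ?_)
      (dependsOn_inter_same dPD (dependsOn_connEvent_leaf hf hleaf h3u h32 h3b))]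
  all_goals simp only [PDEvent, Dtilde, Set.mem_inter_iff, Set.mem_compl_iff, mem_inU, mem_connEvent,
    conn_leaf_open hf hω]

omit [DecidableEq V] [LinearOrder R] in
/-- `P(PD, b ∈ U, o ∈ U)` with the leaf edge open. -/
lemma PDbo_one (h3o : o ≠ a₃) (h31 : a₁ ≠ a₃) (h32 : a₂ ≠ a₃) (h3b : b ≠ a₃) :
    PDbo (Function.update p f 1) ends o a₁ a₂ a₃ b = PDbo (Function.update p f 0) ends o a₁ a₂ u b := by
  unfold PDbo
  have dPD := dependsOn_PD hf hleaf h3u h31 h32 h3u.symm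
  have d1o := dependsOn_connEvent_leaf hf hleaf h3u h31 h3o
  have d2o := dependsOn_connEvent_leaf hf hleaf h3u h32 h3o
  have d1b := dependsOn_connEvent_leaf hf hleaf h3u h31 h3b
  have d2b := dependsOn_connEvent_leaf hf hleaf h3u h32 h3b
  rw [prob_one_eq p (X' := PDEvent ends a₁ a₂ u ∩ (connEvent ends a₁ o ∩ connEvent ends a₁ b))
      (fun ω hω => ?_) (dependsOn_inter_same dPD (dependsOn_inter_same d1o d1b)),
    prob_one_eq p (X' := PDEvent ends a₁ a₂ u ∩ (connEvent ends a₂ o ∩ connEvent ends a₁ b))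
      (fun ω hω => ?_) (dependsOn_inter_same dPD (dependsOn_inter_same d2o d1b)),
    prob_one_eq p (X' := PDEvent ends a₁ a₂ u ∩ (connEvent ends a₁ o ∩ connEvent ends a₂ b))
      (fun ω hω => ?_) (dependsOn_inter_same dPD (dependsOn_inter_same d1o d2b)),
    prob_one_eq p (X' := PDEvent ends a₁ a₂ u ∩ (connEvent ends a₂ o ∩ connEvent ends a₂ b))
      (fun ω hω => ?_) (dependsOn_inter_same dPD (dependsOn_inter_same d2o d2b))]
  all_goals simp only [PDEvent, Dtilde, Set.mem_inter_iff, Set.mem_compl_iff, mem_inU, mem_connEvent,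
    conn_leaf_open hf hω]

/-! ### The leaf edge closed: the `T`-masses vanish -/

omit [DecidableEq V] [LinearOrder R] in
/-- With the leaf edge closed, `T = {a₁ ↮ a₂, a₃ ∈ C₂}` is empty. -/
lemma prob_T_zero (h32 : a₂ ≠ a₃) (Y : Set (Config E)) :
    prob (Function.update p f 0) (TEvent ends a₁ a₂ a₃ ∩ Y) = 0 := by
  refine prob_zero_eq_zero p fun ω hω hx => ?_
  exact (conn_leaf_closed_iff hf hleaf h3u hω h32).1 hx.1.2

omit [DecidableEq V] [LinearOrder R] in
/-- With the leaf edge closed, `T′ = {a₁ ↮ a₂, a₃ ∈ C₁}` is empty. -/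
lemma prob_T'_zero (h31 : a₁ ≠ a₃) (Y : Set (Config E)) :
    prob (Function.update p f 0) (TEvent ends a₂ a₁ a₃ ∩ Y) = 0 := by
  refine prob_zero_eq_zero p fun ω hω hx => ?_
  exact (conn_leaf_closed_iff hf hleaf h3u hω h31).1 hx.1.2

omit [DecidableEq V] [LinearOrder R] in
/-- With the leaf edge closed, `T` itself is empty. -/
lemma prob_T_zero' (h32 : a₂ ≠ a₃) : prob (Function.update p f 0) (TEvent ends a₁ a₂ a₃) = 0 := by
  refine prob_zero_eq_zero p fun ω hω hx => ?_
  exact (conn_leaf_closed_iff hf hleaf h3u hω h32).1 hx.2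

omit [DecidableEq V] [LinearOrder R] in
/-- With the leaf edge closed, `T′` itself is empty. -/
lemma prob_T'_zero' (h31 : a₁ ≠ a₃) : prob (Function.update p f 0) (TEvent ends a₂ a₁ a₃) = 0 := by
  refine prob_zero_eq_zero p fun ω hω hx => ?_
  exact (conn_leaf_closed_iff hf hleaf h3u hω h31).1 hx.2

omit [DecidableEq V] [LinearOrder R] in
/-- `E_Q[σ_b σ₃]` vanishes with the leaf edge closed. -/
lemma EQb3_zero (h31 : a₁ ≠ a₃) (h32 : a₂ ≠ a₃) : EQb3 (Function.update p f 0) ends a₁ a₂ a₃ b = 0 := by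
  unfold EQb3
  rw [prob_T'_zero hf hleaf h3u p a₁ a₂ h31, prob_T_zero hf hleaf h3u p a₁ a₂ h32, prob_T_zero hf hleaf h3u p a₁ a₂ h32,
    prob_T'_zero hf hleaf h3u p a₁ a₂ h31]
  ring

omit [DecidableEq V] [LinearOrder R] in
/-- `E_Q[σ_b σ₃ 1_{o ∈ U}]` vanishes with the leaf edge closed. -/
lemma EQb3o_zero (h31 : a₁ ≠ a₃) (h32 : a₂ ≠ a₃) :
    EQb3o (Function.update p f 0) ends o a₁ a₂ a₃ b = 0 := by
  unfold EQb3o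
  rw [prob_T'_zero hf hleaf h3u p a₁ a₂ h31, prob_T'_zero hf hleaf h3u p a₁ a₂ h31, prob_T_zero hf hleaf h3u p a₁ a₂ h32,
    prob_T_zero hf hleaf h3u p a₁ a₂ h32, prob_T_zero hf hleaf h3u p a₁ a₂ h32, prob_T_zero hf hleaf h3u p a₁ a₂ h32,
    prob_T'_zero hf hleaf h3u p a₁ a₂ h31, prob_T'_zero hf hleaf h3u p a₁ a₂ h31]
  ring

omit [DecidableEq V] [LinearOrder R] in
/-- `E_Q[σ₃]` vanishes with the leaf edge closed. -/
lemma EQ3_zero (h31 : a₁ ≠ a₃) (h32 : a₂ ≠ a₃) : EQ3 (Function.update p f 0) ends a₁ a₂ a₃ = 0 := by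
  unfold EQ3
  rw [prob_T'_zero' hf hleaf h3u p a₁ a₂ h31, prob_T_zero' hf hleaf h3u p a₁ a₂ h32]
  ring

omit [DecidableEq V] [LinearOrder R] in
/-- `E_Q[σ₃ 1_{o ∈ U}]` vanishes with the leaf edge closed. -/
lemma EQ3o_zero (h31 : a₁ ≠ a₃) (h32 : a₂ ≠ a₃) : EQ3o (Function.update p f 0) ends o a₁ a₂ a₃ = 0 := by
  unfold EQ3o
  rw [prob_T'_zero hf hleaf h3u p a₁ a₂ h31, prob_T'_zero hf hleaf h3u p a₁ a₂ h31, prob_T_zero hf hleaf h3u p a₁ a₂ h32,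
    prob_T_zero hf hleaf h3u p a₁ a₂ h32]
  ring

/-! ### The `a₃`-free masses do not see the leaf edge -/

omit [DecidableEq V] [LinearOrder R] in
/-- `P(Q)` does not see `f`. -/
lemma prob_Q_free (h31 : a₁ ≠ a₃) (h32 : a₂ ≠ a₃) :
    prob p (avoidAll ends a₂ {a₁}) = prob (Function.update p f 0) (avoidAll ends a₂ {a₁}) :=
  prob_free_eq p (dependsOn_Q hf hleaf h3u h31 h32)

omit [DecidableEq V] [LinearOrder R] in
/-- `P(Q)` does not see `f` (pinned open). -/
lemma prob_Q_free' (h31 : a₁ ≠ a₃) (h32 : a₂ ≠ a₃) :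
    prob (Function.update p f 1) (avoidAll ends a₂ {a₁}) =
      prob (Function.update p f 0) (avoidAll ends a₂ {a₁}) :=
  prob_free_eq' p (dependsOn_Q hf hleaf h3u h31 h32)

omit [DecidableEq V] [LinearOrder R] in
/-- `E_Q[σ_b σ_o]` does not see `f`. -/
lemma EQbo_free (h3o : o ≠ a₃) (h31 : a₁ ≠ a₃) (h32 : a₂ ≠ a₃) (h3b : b ≠ a₃) :
    EQbo p ends o a₁ a₂ b = EQbo (Function.update p f 0) ends o a₁ a₂ b ∧
      EQbo (Function.update p f 1) ends o a₁ a₂ b = EQbo (Function.update p f 0) ends o a₁ a₂ b := by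
  unfold EQbo
  have dQ := dependsOn_Q hf hleaf h3u h31 h32
  have d1o := dependsOn_connEvent_leaf hf hleaf h3u h31 h3o
  have d2o := dependsOn_connEvent_leaf hf hleaf h3u h32 h3o
  have d1b := dependsOn_connEvent_leaf hf hleaf h3u h31 h3b
  have d2b := dependsOn_connEvent_leaf hf hleaf h3u h32 h3b
  have e1 := dependsOn_inter_same dQ (dependsOn_inter_same d1o d1b)
  have e2 := dependsOn_inter_same dQ (dependsOn_inter_same d2o d2b)
  have e3 := dependsOn_inter_same dQ (dependsOn_inter_same d2o d1b)
  have e4 := dependsOn_inter_same dQ (dependsOn_inter_same d1o d2b)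
  exact ⟨by rw [prob_free_eq p e1, prob_free_eq p e2, prob_free_eq p e3, prob_free_eq p e4],
    by rw [prob_free_eq' p e1, prob_free_eq' p e2, prob_free_eq' p e3, prob_free_eq' p e4]⟩

omit [DecidableEq V] [LinearOrder R] in
/-- `gap` does not see `f`. -/
lemma gap_free (h31 : a₁ ≠ a₃) (h32 : a₂ ≠ a₃) (h3b : b ≠ a₃) :
    gap p ends a₁ a₂ b = gap (Function.update p f 0) ends a₁ a₂ b ∧
      gap (Function.update p f 1) ends a₁ a₂ b = gap (Function.update p f 0) ends a₁ a₂ b := by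
  unfold gap
  have d1b := dependsOn_connEvent_leaf hf hleaf h3u h31 h3b
  have d2b := dependsOn_connEvent_leaf hf hleaf h3u h32 h3b
  exact ⟨by rw [prob_free_eq p d1b, prob_free_eq p d2b], by rw [prob_free_eq' p d1b, prob_free_eq' p d2b]⟩

omit [DecidableEq V] [LinearOrder R] in
/-- `E_Q[σ_o]` does not see `f`. -/
lemma EQo_free (h3o : o ≠ a₃) (h31 : a₁ ≠ a₃) (h32 : a₂ ≠ a₃) :
    EQo p ends o a₁ a₂ = EQo (Function.update p f 0) ends o a₁ a₂ ∧
      EQo (Function.update p f 1) ends o a₁ a₂ = EQo (Function.update p f 0) ends o a₁ a₂ := by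
  unfold EQo
  have dQ := dependsOn_Q hf hleaf h3u h31 h32
  have e1 := dependsOn_inter_same dQ (dependsOn_connEvent_leaf hf hleaf h3u h31 h3o)
  have e2 := dependsOn_inter_same dQ (dependsOn_connEvent_leaf hf hleaf h3u h32 h3o)
  exact ⟨by rw [prob_free_eq p e1, prob_free_eq p e2], by rw [prob_free_eq' p e1, prob_free_eq' p e2]⟩

end Masses

end PMPendant

end Summit.Ventures.PercRepro2
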